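import Summits.CriticalPhenomena.PercolationContinuityZ3.Theorems.Transplant.Bcc111HubRoute
import Summits.CriticalPhenomena.PercolationContinuityZ3.Theorems.Transplant.Bcc111ClawSymm
import Summits.CriticalPhenomena.PercolationContinuityZ3.Theorems.Transplant.Bcc111ClawTableOKA
import Summits.CriticalPhenomena.PercolationContinuityZ3.Theorems.Transplant.Bcc111ClawTableOKB
import Summits.CriticalPhenomena.PercolationContinuityZ3.Theorems.Transplant.Bcc111ClawTableOKC
import Summits.CriticalPhenomena.PercolationContinuityZ3.Theorems.Transplant.Bcc111ClawTableOKD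
import Summits.CriticalPhenomena.PercolationContinuityZ3.Theorems.Transplant.Bcc111ClawTableOKE
import Summits.CriticalPhenomena.PercolationContinuityZ3.Theorems.Transplant.Bcc111ClawTableOKF
import Summits.CriticalPhenomena.PercolationContinuityZ3.Theorems.Transplant.Bcc111ClawTableOKH
import HarnessLib

/-!
# **`θ_{F_m(bcc)}(v, p_c(F_m(bcc))) = 0` FOR EVERY bcc (111)-FILM OF THICKNESS `m ≥ 6` AND EVERY VERTEX — UNCONDITIONAL, p205010-free**:
# the exit-form routing certificate `(Bcc111.hexShadow m).ShapedLinkageX 3` ASSEMBLED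

builds on p205010 (kernel theorem, internal audit signed; external expert review pending) — NOT used in this file.
Lane `prim-bschramm`, seat `prim-bschramm-p2` (gen 48; class C1b = films / other 3D lattices at their own critical point, METHOD = input substitution; memo
`HOME/bschramm/P2-LATTICES.md` §159); helper file (`--supports stmt-CriticalPhenomena-4575 --as helper`).
The bcc (111)-films `F_m(bcc) = bcc ∩ {0 ≤ x₀+x₁+x₂ ≤ m}` carry a hexagonal shadow («Bcc111FilmHexShadow») and «Bcc111FilmLifts» reduced `θ(p_c) = 0` (`m ≥ 3`) to the
finite exit-form certificate `ShapedLinkageX R` of «HexShadowVRouteDataX».  Here the certificate is DISCHARGED for `R = 3` and every `m ≥ 6`: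
* §1 the ten kernel statements (`clawHOK_all`, from «Bcc111ClawTableOK{A,…,H}»: `104 784` configurations checked by `decide +kernel`);
* §2 **`Bcc111.shapedLinkageX_three (hm : 6 ≤ m) : (hexShadow m).ShapedLinkageX 3`** — cleared set «Bcc111ClearedSet» (lift of the cleared columns minus the removed
  extreme vertices), reduction of the certified terminal triple to an admissible configuration of the planar model («Bcc111ClearedSet» §2), a claw for every
  block class («Bcc111ClawSymm».`exists_claw`: kernel classes directly, the mirrored ones by `(a,b) ↦ (a+b,−b)`), and the swap pair of routings from the claw
  («Bcc111HubRoute»: `K_{2,3}` elevator hub + lifted legs);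
* §3 **`Bcc111.theta_criticalProb_eq_zero (hm : 6 ≤ m) (v) : θ_{F_m(bcc)}(v, p_c(F_m(bcc), v)) = 0`** — Duminil-Copin–Sidoravicius–Tassion's slab argument
  transplanted through the hexagonal shadow.  (`m = 1, 2`: «Bcc111FilmCritical».`theta_criticalProb_eq_zero_of_le_two`; `m = 3, 4, 5` remain open here — the hub
  needs the level band `[h, h+3]` inside `[1, m−1]`-safe lifts.)
[cite: DuminilCopinSidoraviciusTassion2016, Thm. 1 and §2.3 (proof of Fact 2)] [cite: BenjaminiSchramm1996, Conj. 4 / Question 3] [cite: ConwaySloane1999, Ch. 4 §7.1]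
-/

noncomputable section

namespace Summit.CriticalPhenomena.PercolationContinuityZ3.Theorems.Transplant

namespace Bcc111

open MeasureTheory Literature.Probability.Percolation Literature.Probability.LatticeModels SimpleGraph
open Slab111 (lev)
open BccClawX (Pt rel)
open Bcc111Claw (ClawHOK admissible admissible_eq tyOK certE certW exists_claw clawHOK_00 clawHOK_01 clawHOK_02 clawHOK_03 clawHOK_11 clawHOK_12 clawHOK_13
  clawHOK_22 clawHOK_23 clawHOK_33)
open scoped Classical

variable {m : ℕ}

/-! ## §1 The kernel statements -/

/-- **The ten kernel classes.** [folklore] -/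
theorem clawHOK_all : ∀ sR sD : ℕ, sR ≤ sD → sD ≤ 3 → ClawHOK sR sD := by
  intro sR sD h1 h2
  interval_cases sD <;> interval_cases sR
  exacts [clawHOK_00, clawHOK_01, clawHOK_11, clawHOK_02, clawHOK_12, clawHOK_22, clawHOK_03, clawHOK_13, clawHOK_23, clawHOK_33]

/-! ## §2 The certificate -/

/-- **THE EXIT-FORM ROUTING CERTIFICATE OF THE bcc (111)-FILMS, `m ≥ 6`**: `(Bcc111.hexShadow m).ShapedLinkageX 3` holds with the cleared set of «Bcc111ClearedSet».
[cite: DuminilCopinSidoraviciusTassion2016, §2.3 (proof of Fact 2: the three disjoint paths in B̄_R(z) ∖ {z})] -/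
theorem shapedLinkageX_three (hm : 6 ≤ m) : (hexShadow m).ShapedLinkageX 3 := by
  intro z tR tD sR sD htRD hsRD hone
  refine ⟨clearedSet m z tR tD sR sD, sh_mem_blkR_of_mem_clearedSet, mem_clearedSet_of_hexBall_one, fun E₁ E₂ w' hT => ?_⟩
  have hm' : (6 : ℤ) ≤ m := by exact_mod_cast hm
  -- the block class
  have hRD : min tR 3 ≤ min tD 3 := min_le_min htRD le_rfl
  have hSD : min sR 3 ≤ min sD 3 := min_le_min hsRD le_rfl
  have hone' : min tR 3 = 3 ∨ min sR 3 = 3 := hone.imp (fun h => min_eq_right h) (fun h => min_eq_right h)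
  -- the terminals in the rerouting / cleared set
  have hE₁W : E₁ ∈ clearedSet m z tR tD sR sD ∩ (hexShadow m).lift (blkR 3 z tR sR) := ⟨hT.E₁W, by rw [HexShadow.mem_lift]; exact hT.E₁R⟩
  have hE₂W : E₂ ∈ clearedSet m z tR tD sR sD ∩ (hexShadow m).lift (blkR 3 z tR sR) := ⟨hT.E₂W, by rw [HexShadow.mem_lift]; exact hT.E₂R⟩
  obtain ⟨hc1, hc2⟩ := certE_of_terminalsX hT
  have hc3 := certW_of_terminalsX hT
  -- admissibility, with the stacked type when `E₁, E₂` share a column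
  have key : ∀ (Ea Eb : bfilm m) (ty : ℕ), ty < 10 → ((E₁ = Ea ∧ E₂ = Eb) ∨ (E₁ = Eb ∧ E₂ = Ea)) →
      tyOK (min tR 3) (min sR 3) (rel z (sh Ea)) (rel z (sh Eb)) ty = true →
      (rel z (sh Ea) = rel z (sh Eb) → lev (pt Ea) < lev (pt Eb) ∧ ((ty / 3 : ℕ) : ℤ) = min (lev (pt Ea)) 2 ∧
        ((ty % 3 : ℕ) : ℤ) = min ((m : ℤ) - lev (pt Eb)) 2) →
      ∃ r₁ r₂ : VRouteData (film m) (clearedSet m z tR tD sR sD ∩ (hexShadow m).lift (blkR 3 z tR sR)) (clearedSet m z tR tD sR sD) E₁ E₂ w',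
        r₁.y = r₂.b ∧ r₁.b = r₂.y := by
    intro Ea Eb ty hty hE htyOK hstk
    have hca : certE (min tR 3) (min tD 3) (min sR 3) (min sD 3) (rel z (sh Ea)) = true ∧ certE (min tR 3) (min tD 3) (min sR 3) (min sD 3) (rel z (sh Eb)) = true ∧
        certW (min tR 3) (min tD 3) (min sR 3) (min sD 3) (rel z (sh Ea)) (rel z (sh Eb)) (rel z (sh w')) = true ∧ Ea ≠ Eb ∧
        Ea ∈ clearedSet m z tR tD sR sD ∩ (hexShadow m).lift (blkR 3 z tR sR) ∧ Eb ∈ clearedSet m z tR tD sR sD ∩ (hexShadow m).lift (blkR 3 z tR sR) := by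
      rcases hE with ⟨rfl, rfl⟩ | ⟨rfl, rfl⟩
      · exact ⟨hc1, hc2, hc3, hT.ne, hE₁W, hE₂W⟩
      · refine ⟨hc2, hc1, ?_, hT.ne.symm, hE₂W, hE₁W⟩
        -- `certW` is symmetric in the two `E`-columns
        have : ∀ (a b c : Pt), certW (min tR 3) (min tD 3) (min sR 3) (min sD 3) a b c = certW (min tR 3) (min tD 3) (min sR 3) (min sD 3) b a c := by
          intro a b c; simp only [certW]
          cases (c == a) <;> cases (c == b) <;> simp [Bool.and_comm, Bool.and_left_comm]
        rw [this]; exact hc3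
    obtain ⟨h1, h2, h3, hne, hEaW, hEbW⟩ := hca
    have hadm : admissible (min tR 3) (min tD 3) (min sR 3) (min sD 3) (rel z (sh Ea)) (rel z (sh Eb)) (rel z (sh w')) ty = true := by
      rw [admissible_eq]; simp only [Bool.and_eq_true]; exact ⟨⟨⟨h1, h2⟩, h3⟩, htyOK⟩
    obtain ⟨Q, i, up, bc, F0, F1, X0, X1, s1, s2, s3, l1, l2, l3, hP⟩ :=
      exists_claw clawHOK_all hRD (min_le_right _ _) hSD (min_le_right _ _) hone' hty hadm
    exact swapPair_of_claw hm z htRD hsRD hP rfl rfl rfl hne hEaW hEbW hT.w'W hstk hE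
  by_cases hsh : sh E₁ = sh E₂
  · -- stacked: the levels differ; order the pair
    have hlev : lev (pt E₁) ≠ lev (pt E₂) := fun h => hT.ne (eq_of_sh_eq_of_lev_eq hsh h)
    have hstacked : ∀ (Ea Eb : bfilm m), ((E₁ = Ea ∧ E₂ = Eb) ∨ (E₁ = Eb ∧ E₂ = Ea)) → sh Ea = sh Eb → lev (pt Ea) < lev (pt Eb) →
        ∃ r₁ r₂ : VRouteData (film m) (clearedSet m z tR tD sR sD ∩ (hexShadow m).lift (blkR 3 z tR sR)) (clearedSet m z tR tD sR sD) E₁ E₂ w',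
          r₁.y = r₂.b ∧ r₁.b = r₂.y := by
      intro Ea Eb hE hshab hlt
      have ha0 : 0 ≤ lev (pt Ea) := Ea.2.1
      have hbm : lev (pt Eb) ≤ m := Eb.2.2
      have hEaW' : Ea ∈ clearedSet m z tR tD sR sD := by rcases hE with ⟨rfl, rfl⟩ | ⟨rfl, rfl⟩; exacts [hT.E₁W, hT.E₂W]
      have hEbW' : Eb ∈ clearedSet m z tR tD sR sD := by rcases hE with ⟨rfl, rfl⟩ | ⟨rfl, rfl⟩; exacts [hT.E₂W, hT.E₁W]
      set τlo : ℕ := (min (lev (pt Ea)) 2).toNat with hτlo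
      set τhi : ℕ := (min ((m : ℤ) - lev (pt Eb)) 2).toNat with hτhi
      have eτlo : (τlo : ℤ) = min (lev (pt Ea)) 2 := Int.toNat_of_nonneg (le_min ha0 (by norm_num))
      have eτhi : (τhi : ℤ) = min ((m : ℤ) - lev (pt Eb)) 2 := Int.toNat_of_nonneg (le_min (by omega) (by norm_num))
      have hτlo2 : τlo ≤ 2 := by have := min_le_right (lev (pt Ea)) 2; omega
      have hτhi2 : τhi ≤ 2 := by have := min_le_right ((m : ℤ) - lev (pt Eb)) 2; omega
      refine key Ea Eb (3 * τlo + τhi) (by omega) hE (tyOK_of_levels hEaW' hEbW' hshab τlo τhi eτlo eτhi) fun _ => ⟨hlt, ?_, ?_⟩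
      · rw [show (3 * τlo + τhi) / 3 = τlo by omega]; exact eτlo
      · rw [show (3 * τlo + τhi) % 3 = τhi by omega]; exact eτhi
    rcases lt_or_gt_of_ne hlev with hlt | hgt
    · exact hstacked E₁ E₂ (Or.inl ⟨rfl, rfl⟩) hsh hlt
    · exact hstacked E₂ E₁ (Or.inr ⟨rfl, rfl⟩) hsh.symm hgt
  · -- distinct columns: type `9`
    have hne' : rel z (sh E₁) ≠ rel z (sh E₂) := fun h => hsh (rel_injective z h)
    refine key E₁ E₂ 9 (by norm_num) (Or.inl ⟨rfl, rfl⟩) ?_ (fun h => absurd h hne')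
    have hb : (rel z (sh E₁) == rel z (sh E₂)) = false := beq_eq_false_iff_ne.2 hne'
    simp [tyOK, hb]

/-! ## §3 The films at their own critical point -/

/-- **THE bcc (111)-FILMS AT THEIR OWN CRITICAL POINT: `θ_{F_m(bcc)}(v, p_c(F_m(bcc))) = 0` for every thickness `m ≥ 6` and every vertex `v`** — UNCONDITIONAL and
p205010-free: Duminil-Copin–Sidoravicius–Tassion's slab argument transplanted through the hexagonal shadow of the film («HexShadow*», «Bcc111Film*»), the exit-form
routing «HexShadowVRoutingX», and the routing certificate of §2 (cleared set minus degenerate extreme vertices, kernel-checked planar hexagonal claws, `K_{2,3}`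
elevator hubs, lifted legs).  [cite: DuminilCopinSidoraviciusTassion2016, Thm. 1 and §2] [cite: BenjaminiSchramm1996, Conj. 4 / Question 3] [cite: ConwaySloane1999, Ch. 4 §7.1] -/
theorem theta_criticalProb_eq_zero (hm : 6 ≤ m) (v : bfilm m) : theta (film m) v (criticalProbIOf (film m) v) = 0 :=
  theta_criticalProb_eq_zero_of_shapedLinkageX (le_trans (by norm_num) hm) (by norm_num : (1 : ℕ) ≤ 3) (shapedLinkageX_three hm) v

/-- **The same, packaged over all thicknesses `m ≥ 6`.** [cite: DuminilCopinSidoraviciusTassion2016, Thm. 1] -/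
theorem theta_criticalProb_eq_zero_all : ∀ m : ℕ, 6 ≤ m → ∀ v : bfilm m, theta (film m) v (criticalProbIOf (film m) v) = 0 :=
  fun _ hm v => theta_criticalProb_eq_zero hm v

end Bcc111

end Summit.CriticalPhenomena.PercolationContinuityZ3.Theorems.Transplant

end
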